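import Summits.RiemannHypothesis.RiemannHypothesis.Theorems.TiltedLandingLaw421R3ClusterQ
import Literature.Analysis.Complex.RoucheTheorem

/-!
# W-08 · C1 (rh-idea-5 g27) — `ClusterQM`: the TILT-CORRECTED MODEL COUNT and the tilted cluster door for STUB 1 (`RestSuccBotQ`)

Purely additive sequel to tree `…R3ClusterQ` (§1–§5 there: conjugation, `succ_of_nonreal_crit(_disc)`, the real-slot lemmas, the
untilted sockets).  Everything here is in the LITERATURE ROUCHÉ CURRENCY `zcountN g a ρ := ((∑ᶠ z ∈ ball a ρ, analyticOrderNatAt g z : ℕ) : ℝ)`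
(suffix `N`; the tree file's `zcount` is the set-builder twin), so that tree `Rouche.finsum_analyticOrderNatAt_eq_of_norm_sub_lt` applies verbatim
and C4 g29's `RhW08.RealCrit.realCritBound_all` (image `realCritBound-W08-C4-rh-idea-6-g29.lean` 965bc2a5) closes `RealCritBoundNSig` by `exact`.
* `RealCritBoundNSig` — the real pigeonhole socket (C4 g29 / C3 g39 have kernel proofs in this exact currency).
* ★ `exists_nonreal_zero_of_counts` — bookkeeping: real count < count ⇒ a non-real zero in the disc (PROVED).
* ★★★ `zcountN_deriv_of_dominatedModel` — MODEL COUNT (PROVED): `G = Q·h`, `h` zero-free on the closed disc, an entire model `M` with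
  `‖G′ − M·h‖ < ‖M·h‖` on the circle ⇒ `G′` has exactly `zcountN M` zeros in the disc.  Untilted `M = Q′`; TILTED `M = Q′ + K·Q` (far field `K`
  frozen at the centre) makes the Rouché defect `Q·h·(h′/h − K)` = the VARIATION of the far field, not its size — toy census (C1 RIDER-11):
  tilted domination with count ≥ real + 2 holds on 6 930 / 7 224 = 95.9 % of non-Ready′ levels of the tilted poly×exp walk (plain: 0 / 2 203 at |γ|·Im v ≥ 1).
* door `TiltClusterLawQ` and ★★★ `tiltClusterLawQ_of_realBound : RealCritBoundNSig → TiltClusterLawQ`.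
* NO LAW is typed here (critic g22 RESULT-30 / (CA387): the column-deep count law `TiltDominationLawQ` of image v1 is FALSE on legal drift
  frames and is STRUCK; `DominatedModel` is a CERTIFICATION DEVICE — the trivial model `(G, 1, G′)` satisfies it — so these are DOOR LEMMAS for
  instances of the residual of record `RhW08.SuccSplit.AntiEscapeCore` (#1053), not a residual).
* §L LATERAL budget: `stTrkDQ_of_lateral`, ★ `succ_of_nonreal_crit_disc_lateral` (disc may overhang the column by δ with `δ² + (j+1)ρ² ≤ (j+1)Hs²`),
  `succ_of_nonreal_crit_disc_either`, `range_of_lateral`; band-deep door ★ `tiltClusterLawQB_of_realBound`.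
* §U UPPER MODEL DOOR (no real pigeonhole, no teeth exposure, complex centre): ★★★ `exists_deriv_zero_of_model_zero` (Rouché `G′` vs `M·h` on a circle
  about `c : ℂ` + a zero of the model inside ⇒ a zero of `G′` inside) and ★★★ `succ_of_upper_model_zero` (disc off the real axis, `ρ ≤ |Im c|`,
  column-deep or lateral budget at radius `ρ + |Im c|` about `Re c` ⇒ level-`(j+1)` band state).
Nothing here bears on the truth of RH; `TiltedLandingLaw421` (24774) stays OPEN.
-/

namespace RhW08.ClusterQM

open Complex Set
open scoped ComplexConjugate
open Literature.Analysis.Complex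
open RhIdea6.G17.W07C7 RhIdea6.G17.W07C7.Rev6 RhIdea6.G18.W07C8.Law421BirthS RhIdea6.G19.W07C11.Seam
open RhIdea6.G20.W07C12.Frac RhIdea6.G20.W07C12.StColP RhW07.C12.FieldSplit RhIdea6.G21.W07C13.TentMax
open RhW07.C14.TwoSided RhW07.C14.Classes RhW07.C14.Lineage RhW07.C14.Booking
open RhW07.C13.Heredity RhIdea6.G22.W07C15pre.Injection RhW07.E3.Cell RhW07.E3.Lit
open RhW08.Round1 RhW08.StSwap RhW08.Round2 RhW08.QuadW RhW08.SealSwapQ RhW08.SuccB RhW08.SuccSplit RhW08.SuccTheft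
open RhW08.Column RhW08.Hurwitz
open RhW08.ClusterQ

/-- Zero count (with multiplicity) of `g` in the open disc `ball a ρ` — the currency of
`Literature.Analysis.Complex.Rouche.finsum_analyticOrderNatAt_eq_of_norm_sub_lt`, cast to `ℝ`. -/
noncomputable def zcountN (g : ℂ → ℂ) (a ρ : ℝ) : ℝ :=
  ((∑ᶠ z ∈ Metric.ball (a : ℂ) ρ, analyticOrderNatAt g z : ℕ) : ℝ)

/-- Real-zero count (with multiplicity) of `g` in the open disc. -/
noncomputable def zcountNReal (g : ℂ → ℂ) (a ρ : ℝ) : ℝ :=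
  ((∑ᶠ z ∈ Metric.ball (a : ℂ) ρ ∩ {z : ℂ | z.im = 0}, analyticOrderNatAt g z : ℕ) : ℝ)

/-- Non-real-zero count (with multiplicity) of `g` in the open disc. -/
noncomputable def zcountNNonreal (g : ℂ → ℂ) (a ρ : ℝ) : ℝ :=
  ((∑ᶠ z ∈ Metric.ball (a : ℂ) ρ ∩ {z : ℂ | z.im ≠ 0}, analyticOrderNatAt g z : ℕ) : ℝ)

/-- SOCKET (real pigeonhole, C1/C2): at a NON-Ready′ level `j` whose disc slice lies in range, the real critical points of
`f^{(j)}` in the disc number at most (real zeros of `f^{(j)}` in the disc, with multiplicity) `+ 1` — one simple critical point per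
zero-free slot (§3, §4) and `μ − 1` at a tooth of multiplicity `μ`. -/
def RealCritBoundNSig : Prop :=
  ∀ (η : ℝ) (f : ℂ → ℂ) (x₀ s hmax R Hs : ℝ) (B : ℕ), EngineHyps5 2 η f x₀ s hmax R Hs B →
    ∀ (j : ℕ) (v : ℂ) (a ρ : ℝ), iteratedDeriv j f ≠ 0 → ¬ ReadyR2 η f x₀ s hmax R Hs B j v →
      |a - x₀| + ρ < ((j : ℝ) + 3) * R / 2 →
      zcountNReal (iteratedDeriv (j + 1) f) a ρ ≤ zcountNReal (iteratedDeriv j f) a ρ + 1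

/-- The support of `analyticOrderNatAt g` inside a disc is contained in the zero set of `g` there (finite for entire `g ≠ 0`). -/
theorem finite_inter_support {g : ℂ → ℂ} (hg : Differentiable ℂ g) (hne : g ≠ 0) (a ρ : ℝ) (A : Set ℂ) :
    (Metric.ball (a : ℂ) ρ ∩ A ∩ Function.support (analyticOrderNatAt g)).Finite := by
  refine (finite_zeros_closedBall_of_entire hg hne (a : ℂ) ρ).subset ?_
  intro u hu
  exact ⟨Metric.ball_subset_closedBall hu.1.1, apply_eq_zero_of_analyticOrderNatAt_ne_zero hu.2⟩

/-- ★ POINTWISE WITNESS (PROVED): if the real-zero count of an entire `g ≠ 0` in the disc is SMALLER than its zero count there,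
`g` has a non-real zero in the disc (`zcountN = zcountNReal + zcountNNonreal` over the finite zero set). -/
theorem exists_nonreal_zero_of_counts {g : ℂ → ℂ} {a ρ : ℝ} (hgd : Differentiable ℂ g) (hgne : g ≠ 0)
    (hlt : zcountNReal g a ρ < zcountN g a ρ) : ∃ z : ℂ, g z = 0 ∧ z.im ≠ 0 ∧ ‖z - (a : ℂ)‖ < ρ := by
  have hset : Metric.ball (a : ℂ) ρ = (Metric.ball (a : ℂ) ρ ∩ {z : ℂ | z.im = 0}) ∪ (Metric.ball (a : ℂ) ρ ∩ {z : ℂ | z.im ≠ 0}) := by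
    ext u; simp only [mem_inter_iff, mem_setOf_eq, mem_union]; tauto
  have hdisj : Disjoint (Metric.ball (a : ℂ) ρ ∩ {z : ℂ | z.im = 0}) (Metric.ball (a : ℂ) ρ ∩ {z : ℂ | z.im ≠ 0}) :=
    Set.disjoint_left.mpr fun u hu hu' => hu'.2 hu.2
  have hsplitN : (∑ᶠ z ∈ Metric.ball (a : ℂ) ρ, analyticOrderNatAt g z) =
      (∑ᶠ z ∈ Metric.ball (a : ℂ) ρ ∩ {z : ℂ | z.im = 0}, analyticOrderNatAt g z) +
        ∑ᶠ z ∈ Metric.ball (a : ℂ) ρ ∩ {z : ℂ | z.im ≠ 0}, analyticOrderNatAt g z := by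
    conv_lhs => rw [hset]
    exact finsum_mem_union' hdisj (finite_inter_support hgd hgne a ρ _) (finite_inter_support hgd hgne a ρ _)
  have hsplit : zcountN g a ρ = zcountNReal g a ρ + zcountNNonreal g a ρ := by
    unfold zcountN zcountNReal zcountNNonreal; rw [hsplitN, Nat.cast_add]
  have hpos : 0 < zcountNNonreal g a ρ := by linarith
  by_contra hno
  push Not at hno
  have hzero : (Metric.ball (a : ℂ) ρ ∩ {z : ℂ | z.im ≠ 0}).EqOn (analyticOrderNatAt g) 0 := by
    intro u hu
    have hub : ‖u - (a : ℂ)‖ < ρ := by have := hu.1; rwa [Metric.mem_ball, dist_eq_norm] at this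
    have hgu : g u ≠ 0 := fun h0 => absurd hub (not_lt.mpr (hno u h0 hu.2))
    show analyticOrderNatAt g u = 0
    simp [analyticOrderNatAt, (hgd.analyticAt u).analyticOrderAt_eq_zero.mpr hgu]
  have h0 : zcountNNonreal g a ρ = 0 := by
    unfold zcountNNonreal; rw [finsum_mem_of_eqOn_zero hzero]; simp
  linarith

/-- Multiplying by a function analytic and non-vanishing at `z` does not change the order of vanishing. -/
theorem analyticOrderNatAt_mul_of_ne_zero {Q h : ℂ → ℂ} {z : ℂ} (hQ : AnalyticAt ℂ Q z) (hh : AnalyticAt ℂ h z) (hz : h z ≠ 0) :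
    analyticOrderNatAt (Q * h) z = analyticOrderNatAt Q z := by
  unfold analyticOrderNatAt
  rw [analyticOrderAt_mul hQ hh, hh.analyticOrderAt_eq_zero.mpr hz, add_zero]

/-- `zcountN` is unchanged by a factor zero-free on the closed disc. -/
theorem zcountN_mul_of_ne_zero {Q h : ℂ → ℂ} {a ρ : ℝ} (hQ : Differentiable ℂ Q) (hh : Differentiable ℂ h)
    (hh0 : ∀ z : ℂ, ‖z - (a : ℂ)‖ ≤ ρ → h z ≠ 0) : zcountN (Q * h) a ρ = zcountN Q a ρ := by
  unfold zcountN
  congr 1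
  refine finsum_mem_congr rfl fun z hz => ?_
  have hzb : ‖z - (a : ℂ)‖ ≤ ρ := by rw [Metric.mem_ball, dist_eq_norm] at hz; exact hz.le
  exact analyticOrderNatAt_mul_of_ne_zero (hQ.analyticAt z) (hh.analyticAt z) (hh0 z hzb)

/-- DOMINATED MODEL for `G` in `D(a, ρ)`: `G = Q·h`, `h` zero-free on the closed disc, an entire MODEL `M` for `G′/h` with known
zero count `n` in the disc and Rouché domination `‖G′ − M·h‖ < ‖M·h‖` on the circle. (`M = Q′`: §5/§6; `M = Q′ + K·Q`: tilted.) -/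
def DominatedModel (G : ℂ → ℂ) (a ρ n : ℝ) : Prop :=
  ∃ Q h M : ℂ → ℂ, Differentiable ℂ Q ∧ Differentiable ℂ h ∧ Differentiable ℂ M ∧ (∀ z : ℂ, G z = Q z * h z) ∧
    (∀ z : ℂ, ‖z - (a : ℂ)‖ ≤ ρ → h z ≠ 0) ∧ zcountN M a ρ = n ∧
    (∀ z : ℂ, ‖z - (a : ℂ)‖ = ρ → ‖deriv G z - M z * h z‖ < ‖M z * h z‖)

/-- ★★★ MODEL COUNT (PROVED): under a dominated model, `G′` has exactly `n` zeros in the disc (Rouché `G′` vs `M·h`, then the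
zero-free factor `h` drops out of the count). -/
theorem zcountN_deriv_of_dominatedModel {G : ℂ → ℂ} {a ρ n : ℝ} (hρ : 0 < ρ) (hG : Differentiable ℂ G)
    (hD : DominatedModel G a ρ n) : zcountN (deriv G) a ρ = n := by
  obtain ⟨Q, h, M, hQ, hh, hM, hGQ, hh0, hMc, hdom⟩ := hD
  have hdG : Differentiable ℂ (deriv G) := by
    have := differentiable_iteratedDeriv_of_entire hG 1; rwa [iteratedDeriv_one] at this
  have hg₁ : Differentiable ℂ (M * h) := hM.mul hh
  have hRou := Rouche.finsum_analyticOrderNatAt_eq_of_norm_sub_lt (deriv G) (M * h) (a : ℂ) ρ hρ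
    ⟨Set.univ, isOpen_univ, Set.subset_univ _, hdG.differentiableOn, hg₁.differentiableOn⟩
    (fun z hz => by
      have hz' : ‖z - (a : ℂ)‖ = ρ := by rw [Metric.mem_sphere, dist_eq_norm] at hz; exact hz
      rw [Pi.mul_apply]; exact hdom z hz')
  have h1 : zcountN (deriv G) a ρ = zcountN (M * h) a ρ := by unfold zcountN; exact_mod_cast congrArg (fun n : ℕ => (n : ℝ)) hRou
  rw [h1, zcountN_mul_of_ne_zero hM hh hh0, hMc]

/-- ★ THE TILTED CLUSTER DOOR: legal frame, band state `v` at level `j`, not Ready′, a column-deep disc `D(a, ρ)` on which `f^{(j)}`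
admits a dominated model with count `n ≥ (real zeros of f^{(j)} in the disc) + 2` ⇒ a level-`(j+1)` band state.
(Toy census RIDER-11: with `M = Q′ + γQ`, `Q` = all zeros inside the disc, radii `ρ ∈ {1.3 … 5}·Im v`, the domination
`|Σ_outside 1/(z−w)| < |Q′/Q + γ|` holds on 6 930 / 7 224 unready levels (95.9 %), column-deep on 2 159, successor confirmed 2 159 / 2 159.) -/
def TiltClusterLawQ : Prop :=
  ∀ (η : ℝ) (f : ℂ → ℂ) (x₀ s hmax R Hs : ℝ) (B : ℕ), EngineHyps5 2 η f x₀ s hmax R Hs B →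
    ∀ (j : ℕ) (v : ℂ) (a ρ n : ℝ), StTrkDQ η f x₀ s hmax R Hs B j v → ¬ ReadyR2 η f x₀ s hmax R Hs B j v →
      0 < ρ → |a - x₀| + ρ ≤ R / 2 → DominatedModel (iteratedDeriv j f) a ρ n →
      zcountNReal (iteratedDeriv j f) a ρ + 2 ≤ n →
      ∃ u : ℂ, StTrkDQ η f x₀ s hmax R Hs B (j + 1) u

/-- ★★★ The tilted cluster door hangs on the real pigeonhole ALONE. -/
theorem tiltClusterLawQ_of_realBound (hRB : RealCritBoundNSig) : TiltClusterLawQ := by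
  intro η f x₀ s hmax R Hs B hE j v a ρ n hv hnr hρ hcol hD hn
  have hRpos : 0 < R := R_pos_of_engine hE
  have hcount := zcountN_deriv_of_dominatedModel hρ (differentiable_iteratedDeriv_of_entire hE.1 j) hD
  rw [← iteratedDeriv_succ] at hcount
  have hrange : |a - x₀| + ρ < ((j : ℝ) + 3) * R / 2 := by
    have hj : (0 : ℝ) ≤ (j : ℝ) := Nat.cast_nonneg j
    nlinarith
  have hreal := hRB η f x₀ s hmax R Hs B hE j v a ρ hv.1 hnr hrange
  obtain ⟨z, hz, hzim, hza⟩ := exists_nonreal_zero_of_counts (differentiable_iteratedDeriv_of_entire hE.1 (j + 1))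
    (iteratedDeriv_succ_ne_zero_of_zero hE.1 j hv.1 hv.2.1) (by linarith)
  exact succ_of_nonreal_crit_disc hE hv hcol hz hzim hza.le

/-! ## §L LATERAL budget instead of column depth (critic RESULT-30 (R1)) -/

/-- Band membership at level `j` from an explicit LATERAL budget: an upper zero `u` of `f^{(j)} ≢ 0` with
`max(|Re u − x₀| − R/2, 0)² + j·Im u² ≤ j·Hs²` is a band state (`Im u ≤ Hs` by strip heredity). -/
theorem stTrkDQ_of_lateral {η : ℝ} {f : ℂ → ℂ} {x₀ s hmax R Hs : ℝ} {B : ℕ} (hE : EngineHyps5 2 η f x₀ s hmax R Hs B)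
    {j : ℕ} (hnz : iteratedDeriv j f ≠ 0) {u : ℂ} (hu : iteratedDeriv j f u = 0) (hup : 0 < u.im)
    (hlat : (max (|u.re - x₀| - R / 2) 0) ^ 2 + (j : ℝ) * u.im ^ 2 ≤ (j : ℝ) * Hs ^ 2) :
    StTrkDQ η f x₀ s hmax R Hs B j u := by
  have him : u.im ≤ Hs := by
    have := abs_im_le_of_level hE hnz hu
    rwa [abs_of_pos hup] at this
  exact ⟨hnz, hu, hup, hlat, him⟩

/-- ★ LATERAL-TOLERANT SUCCESSOR: legal frame, band state `v` at level `j`, a non-real zero `z` of `f^{(j+1)}` with `‖z − a‖ ≤ ρ`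
(`a` real), and the lateral budget `max(|a − x₀| + ρ − R/2, 0)² + (j+1)·ρ² ≤ (j+1)·Hs²` ⇒ a level-`(j+1)` band state. -/
theorem succ_of_nonreal_crit_disc_lateral {η : ℝ} {f : ℂ → ℂ} {x₀ s hmax R Hs : ℝ} {B j : ℕ} {v z : ℂ} {a ρ : ℝ}
    (hE : EngineHyps5 2 η f x₀ s hmax R Hs B) (hv : StTrkDQ η f x₀ s hmax R Hs B j v)
    (hz : iteratedDeriv (j + 1) f z = 0) (hzim : z.im ≠ 0) (hza : ‖z - (a : ℂ)‖ ≤ ρ)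
    (hlat : (max (|a - x₀| + ρ - R / 2) 0) ^ 2 + ((j : ℝ) + 1) * ρ ^ 2 ≤ ((j : ℝ) + 1) * Hs ^ 2) :
    ∃ u : ℂ, StTrkDQ η f x₀ s hmax R Hs B (j + 1) u := by
  obtain ⟨u, hu, hup, hure, huim⟩ := exists_upper_zero_of_nonreal hE.1 hE.2.1 (j + 1) hz hzim
  have hnz : iteratedDeriv (j + 1) f ≠ 0 := iteratedDeriv_succ_ne_zero_of_zero hE.1 j hv.1 hv.2.1
  refine ⟨u, stTrkDQ_of_lateral hE hnz hu hup ?_⟩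
  -- real part: |Re u − a| ≤ ‖z − a‖ ≤ ρ
  have hre : |u.re - a| ≤ ρ := by
    have h1 : |(z - (a : ℂ)).re| ≤ ‖z - (a : ℂ)‖ := Complex.abs_re_le_norm _
    have h2 : (z - (a : ℂ)).re = z.re - a := by simp
    rw [h2] at h1; rw [hure]; linarith
  -- imaginary part: Im u = |Im z| ≤ ‖z − a‖ ≤ ρ
  have himρ : u.im ≤ ρ := by
    have h1 : |(z - (a : ℂ)).im| ≤ ‖z - (a : ℂ)‖ := Complex.abs_im_le_norm _
    have h2 : (z - (a : ℂ)).im = z.im := by simp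
    rw [h2] at h1
    have : u.im = |z.im| := by rw [← huim, abs_of_pos hup]
    rw [this]; linarith
  have hρ0 : 0 ≤ ρ := le_trans (norm_nonneg _) hza
  have hover : |u.re - x₀| - R / 2 ≤ |a - x₀| + ρ - R / 2 := by
    have : |u.re - x₀| ≤ |u.re - a| + |a - x₀| := by
      have := abs_add_le (u.re - a) (a - x₀); simp only [sub_add_sub_cancel] at this; exact this
    linarith
  have hmax : max (|u.re - x₀| - R / 2) 0 ≤ max (|a - x₀| + ρ - R / 2) 0 := max_le_max hover le_rfl
  have hmax0 : 0 ≤ max (|u.re - x₀| - R / 2) 0 := le_max_right _ _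
  have hsq : (max (|u.re - x₀| - R / 2) 0) ^ 2 ≤ (max (|a - x₀| + ρ - R / 2) 0) ^ 2 := pow_le_pow_left₀ hmax0 hmax 2
  have hj : (0 : ℝ) ≤ (j : ℝ) + 1 := by positivity
  have him2 : u.im ^ 2 ≤ ρ ^ 2 := pow_le_pow_left₀ hup.le himρ 2
  have hcast : ((j + 1 : ℕ) : ℝ) = (j : ℝ) + 1 := by push_cast; ring
  rw [hcast]
  nlinarith [mul_le_mul_of_nonneg_left him2 hj]

/-- Column-deep OR lateral budget ⇒ successor (the disjunction the doors should carry). -/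
theorem succ_of_nonreal_crit_disc_either {η : ℝ} {f : ℂ → ℂ} {x₀ s hmax R Hs : ℝ} {B j : ℕ} {v z : ℂ} {a ρ : ℝ}
    (hE : EngineHyps5 2 η f x₀ s hmax R Hs B) (hv : StTrkDQ η f x₀ s hmax R Hs B j v)
    (hz : iteratedDeriv (j + 1) f z = 0) (hzim : z.im ≠ 0) (hza : ‖z - (a : ℂ)‖ ≤ ρ)
    (h : |a - x₀| + ρ ≤ R / 2 ∨ (max (|a - x₀| + ρ - R / 2) 0) ^ 2 + ((j : ℝ) + 1) * ρ ^ 2 ≤ ((j : ℝ) + 1) * Hs ^ 2) :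
    ∃ u : ℂ, StTrkDQ η f x₀ s hmax R Hs B (j + 1) u := by
  rcases h with hcol | hlat
  · exact succ_of_nonreal_crit_disc hE hv hcol hz hzim hza
  · exact succ_of_nonreal_crit_disc_lateral hE hv hz hzim hza hlat

/-- Range control from the lateral budget (for `RealCritBoundSig`-type sockets): `|a − x₀| + ρ < (j+3)·R/2` (uses `Hs ≤ R/2`, `0 < R`; no sign needed on `ρ`). -/
theorem range_of_lateral {η : ℝ} {f : ℂ → ℂ} {x₀ s hmax R Hs : ℝ} {B j : ℕ} {a ρ : ℝ} (hE : EngineHyps5 2 η f x₀ s hmax R Hs B)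
    (hlat : (max (|a - x₀| + ρ - R / 2) 0) ^ 2 + ((j : ℝ) + 1) * ρ ^ 2 ≤ ((j : ℝ) + 1) * Hs ^ 2) :
    |a - x₀| + ρ < ((j : ℝ) + 3) * R / 2 := by
  have hRpos : 0 < R := R_pos_of_engine hE
  have hHs : 0 ≤ Hs := hE.2.2.2.2.2.2.2.1
  have hHsR : 2 * Hs ≤ R := hE.2.2.2.2.2.2.2.2.2.1
  have hj : (0 : ℝ) ≤ (j : ℝ) := Nat.cast_nonneg j
  set δ := max (|a - x₀| + ρ - R / 2) 0 with hδ
  have hδ0 : 0 ≤ δ := le_max_right _ _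
  have hnn : 0 ≤ ((j : ℝ) + 1) * Hs := by positivity
  have hδ1 : δ ^ 2 ≤ ((j : ℝ) + 1) * Hs ^ 2 := by
    have : 0 ≤ ((j : ℝ) + 1) * ρ ^ 2 := by positivity
    linarith
  have hδ2 : δ ^ 2 ≤ (((j : ℝ) + 1) * Hs) ^ 2 := by
    have : ((j : ℝ) + 1) * Hs ^ 2 ≤ (((j : ℝ) + 1) * Hs) ^ 2 := by
      have h3 : 0 ≤ ((j : ℝ) + 1) * (j : ℝ) * Hs ^ 2 := by positivity
      nlinarith
    linarith
  have hδle : δ ≤ ((j : ℝ) + 1) * Hs := by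
    by_contra hcon
    push Not at hcon
    have := mul_self_lt_mul_self hnn hcon
    nlinarith
  have hge : |a - x₀| + ρ - R / 2 ≤ δ := le_max_left _ _
  nlinarith

/-- ★ BAND-DEEP TILTED DOOR: as `TiltClusterLawQ` but the disc may overhang the column under the lateral budget. -/
theorem tiltClusterLawQB_of_realBound (hRB : RealCritBoundNSig) {η : ℝ} {f : ℂ → ℂ} {x₀ s hmax R Hs : ℝ} {B : ℕ}
    (hE : EngineHyps5 2 η f x₀ s hmax R Hs B) {j : ℕ} {v : ℂ} {a ρ n : ℝ} (hv : StTrkDQ η f x₀ s hmax R Hs B j v)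
    (hnr : ¬ ReadyR2 η f x₀ s hmax R Hs B j v) (hρ : 0 < ρ)
    (hdepth : |a - x₀| + ρ ≤ R / 2 ∨ (max (|a - x₀| + ρ - R / 2) 0) ^ 2 + ((j : ℝ) + 1) * ρ ^ 2 ≤ ((j : ℝ) + 1) * Hs ^ 2)
    (hD : DominatedModel (iteratedDeriv j f) a ρ n) (hn : zcountNReal (iteratedDeriv j f) a ρ + 2 ≤ n) :
    ∃ u : ℂ, StTrkDQ η f x₀ s hmax R Hs B (j + 1) u := by
  have hRpos : 0 < R := R_pos_of_engine hE
  have hcount := zcountN_deriv_of_dominatedModel hρ (differentiable_iteratedDeriv_of_entire hE.1 j) hD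
  rw [← iteratedDeriv_succ] at hcount
  have hrange : |a - x₀| + ρ < ((j : ℝ) + 3) * R / 2 := by
    rcases hdepth with hcol | hlat
    · have hj : (0 : ℝ) ≤ (j : ℝ) := Nat.cast_nonneg j
      nlinarith
    · exact range_of_lateral hE hlat
  have hreal := hRB η f x₀ s hmax R Hs B hE j v a ρ hv.1 hnr hrange
  obtain ⟨z, hz, hzim, hza⟩ := exists_nonreal_zero_of_counts (differentiable_iteratedDeriv_of_entire hE.1 (j + 1))
    (iteratedDeriv_succ_ne_zero_of_zero hE.1 j hv.1 hv.2.1) (by linarith)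
  exact succ_of_nonreal_crit_disc_either hE hv hz hzim hza.le hdepth

/-! ## §U The UPPER MODEL DOOR: complex centre, disc off the real axis — no real pigeonhole at all -/

/-- An entire function vanishing on a neighbourhood of a point is identically zero (identity theorem, packaged). -/
theorem eq_zero_of_eventuallyEq_zero {M : ℂ → ℂ} (hM : Differentiable ℂ M) {z₀ : ℂ} (h : ∀ᶠ z in nhds z₀, M z = 0) : M = 0 := by
  have hfr : AnalyticOnNhd ℂ M Set.univ := fun z _ => hM.analyticAt z
  have := hfr.eqOn_zero_of_preconnected_of_eventuallyEq_zero isPreconnected_univ (Set.mem_univ z₀) h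
  funext z; exact this (Set.mem_univ z)

/-- At a zero `z₀` of an entire `M ≢ 0` the natural order of vanishing is positive. -/
theorem analyticOrderNatAt_pos_of_zero {M : ℂ → ℂ} (hM : Differentiable ℂ M) (hMne : M ≠ 0) {z₀ : ℂ} (hz : M z₀ = 0) :
    0 < analyticOrderNatAt M z₀ := by
  rw [Nat.pos_iff_ne_zero]
  simp only [analyticOrderNatAt, ne_eq]
  intro h0
  rcases ENat.toNat_eq_zero.mp h0 with h1 | h2
  · exact ((hM.analyticAt z₀).analyticOrderAt_eq_zero.mp h1) hz
  · rw [analyticOrderAt_eq_top] at h2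
    exact hMne (eq_zero_of_eventuallyEq_zero hM h2)

/-- ★★★ MODEL ZERO ⇒ CRITICAL POINT (PROVED): `G` entire, `h` entire and zero-free on the closed disc `‖z − c‖ ≤ ρ` (`c : ℂ`), an entire model
`M ≢ 0` with Rouché domination `‖G′ − M·h‖ < ‖M·h‖` on the circle and a zero of `M` inside ⇒ `G′` has a zero inside.
(The factorisation `G = Q·h` is how hands BUILD `M`, e.g. `M = Q′ + K·Q`; the lemma itself needs only the circle inequality.) -/
theorem exists_deriv_zero_of_model_zero {G h M : ℂ → ℂ} {c : ℂ} {ρ : ℝ} (hρ : 0 < ρ) (hG : Differentiable ℂ G)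
    (hh : Differentiable ℂ h) (hM : Differentiable ℂ M) (hMne : M ≠ 0)
    (hh0 : ∀ z : ℂ, ‖z - c‖ ≤ ρ → h z ≠ 0) (hdom : ∀ z : ℂ, ‖z - c‖ = ρ → ‖deriv G z - M z * h z‖ < ‖M z * h z‖)
    (hMz : ∃ z₀ : ℂ, ‖z₀ - c‖ < ρ ∧ M z₀ = 0) : ∃ u : ℂ, ‖u - c‖ < ρ ∧ deriv G u = 0 := by
  have hdG : Differentiable ℂ (deriv G) := by
    have := differentiable_iteratedDeriv_of_entire hG 1; rwa [iteratedDeriv_one] at this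
  have hg₁ : Differentiable ℂ (M * h) := hM.mul hh
  have hRou := Rouche.finsum_analyticOrderNatAt_eq_of_norm_sub_lt (deriv G) (M * h) c ρ hρ
    ⟨Set.univ, isOpen_univ, Set.subset_univ _, hdG.differentiableOn, hg₁.differentiableOn⟩
    (fun z hz => by
      have hz' : ‖z - c‖ = ρ := by rw [Metric.mem_sphere, dist_eq_norm] at hz; exact hz
      rw [Pi.mul_apply]; exact hdom z hz')
  obtain ⟨z₀, hz₀, hMz₀⟩ := hMz
  have hz₀h : h z₀ ≠ 0 := hh0 z₀ hz₀.le
  -- `M * h ≢ 0`: else `M` vanishes near `z₀` (where `h ≠ 0`), hence everywhere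
  have hMhne : M * h ≠ 0 := by
    intro h0
    have hnhd : ∀ᶠ z in nhds z₀, M z = 0 := by
      have hne : ∀ᶠ z in nhds z₀, h z ≠ 0 := (hh z₀).continuousAt.eventually_ne hz₀h
      refine hne.mono fun z hz => ?_
      have := congrArg (fun F => F z) h0
      simp only [Pi.mul_apply, Pi.zero_apply, mul_eq_zero] at this
      exact this.resolve_right hz
    exact hMne (eq_zero_of_eventuallyEq_zero hM hnhd)
  have hfin : (Metric.ball c ρ ∩ Function.support (analyticOrderNatAt (M * h))).Finite := by
    apply (finite_zeros_closedBall_of_entire hg₁ hMhne c ρ).subset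
    intro u hu
    exact ⟨Metric.ball_subset_closedBall hu.1, apply_eq_zero_of_analyticOrderNatAt_ne_zero (Function.mem_support.mp hu.2)⟩
  have hordz₀ : 0 < analyticOrderNatAt (M * h) z₀ := by
    rw [analyticOrderNatAt_mul_of_ne_zero (hM.analyticAt z₀) (hh.analyticAt z₀) hz₀h]
    exact analyticOrderNatAt_pos_of_zero hM hMne hMz₀
  have hpos : 0 < ∑ᶠ z ∈ Metric.ball c ρ, analyticOrderNatAt (M * h) z := by
    rw [finsum_mem_eq_sum _ hfin]
    apply Finset.sum_pos'
    · intro i _; exact Nat.zero_le _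
    · refine ⟨z₀, ?_, hordz₀⟩
      rw [Set.Finite.mem_toFinset]
      exact ⟨by rw [Metric.mem_ball, dist_eq_norm]; exact hz₀, Function.mem_support.mpr hordz₀.ne'⟩
  rw [← hRou] at hpos
  by_contra hno
  push Not at hno
  have hzero : (Metric.ball c ρ).EqOn (analyticOrderNatAt (deriv G)) 0 := by
    intro u hu
    have hub : ‖u - c‖ < ρ := by rwa [Metric.mem_ball, dist_eq_norm] at hu
    have hgu : deriv G u ≠ 0 := hno u hub
    show analyticOrderNatAt (deriv G) u = 0
    simp [analyticOrderNatAt, (hdG.analyticAt u).analyticOrderAt_eq_zero.mpr hgu]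
  rw [finsum_mem_of_eqOn_zero hzero] at hpos
  exact lt_irrefl _ hpos

/-- ★★★ THE UPPER MODEL DOOR: legal frame, band state `v` at level `j`; a disc `‖z − c‖ ≤ ρ` OFF THE REAL AXIS (`ρ ≤ |Im c|`) on which an
entire `h` is zero-free, an entire model `M ≢ 0` dominating `f^{(j+1)}` against `M·h` on the circle and vanishing somewhere inside, and depth
(column-deep OR lateral budget) for the real-centred disc `D(Re c, ρ + |Im c|)` ⇒ a level-`(j+1)` band state.  No real pigeonhole, no teeth. -/
theorem succ_of_upper_model_zero {η : ℝ} {f : ℂ → ℂ} {x₀ s hmax R Hs : ℝ} {B j : ℕ} {v : ℂ} (hE : EngineHyps5 2 η f x₀ s hmax R Hs B)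
    (hv : StTrkDQ η f x₀ s hmax R Hs B j v) {c : ℂ} {ρ : ℝ} (hρ : 0 < ρ) (hoff : ρ ≤ |c.im|) {h M : ℂ → ℂ}
    (hh : Differentiable ℂ h) (hM : Differentiable ℂ M) (hMne : M ≠ 0) (hh0 : ∀ z : ℂ, ‖z - c‖ ≤ ρ → h z ≠ 0)
    (hdom : ∀ z : ℂ, ‖z - c‖ = ρ → ‖iteratedDeriv (j + 1) f z - M z * h z‖ < ‖M z * h z‖)
    (hMz : ∃ z₀ : ℂ, ‖z₀ - c‖ < ρ ∧ M z₀ = 0)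
    (hdepth : |c.re - x₀| + (ρ + |c.im|) ≤ R / 2 ∨
      (max (|c.re - x₀| + (ρ + |c.im|) - R / 2) 0) ^ 2 + ((j : ℝ) + 1) * (ρ + |c.im|) ^ 2 ≤ ((j : ℝ) + 1) * Hs ^ 2) :
    ∃ u : ℂ, StTrkDQ η f x₀ s hmax R Hs B (j + 1) u := by
  have hG : Differentiable ℂ (iteratedDeriv j f) := differentiable_iteratedDeriv_of_entire hE.1 j
  have hdom' : ∀ z : ℂ, ‖z - c‖ = ρ → ‖deriv (iteratedDeriv j f) z - M z * h z‖ < ‖M z * h z‖ := by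
    intro z hz; rw [← iteratedDeriv_succ]; exact hdom z hz
  obtain ⟨u, huc, hu⟩ := exists_deriv_zero_of_model_zero hρ hG hh hM hMne hh0 hdom' hMz
  rw [← iteratedDeriv_succ] at hu
  have huim : u.im ≠ 0 := by
    intro h0
    have h1 : |(u - c).im| ≤ ‖u - c‖ := Complex.abs_im_le_norm _
    have h2 : (u - c).im = u.im - c.im := by simp
    rw [h2, h0, zero_sub, abs_neg] at h1
    linarith
  have hua : ‖u - ((c.re : ℝ) : ℂ)‖ ≤ ρ + |c.im| := by
    have hsplit : u - ((c.re : ℝ) : ℂ) = (u - c) + (c - ((c.re : ℝ) : ℂ)) := by ring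
    have hci : ‖c - ((c.re : ℝ) : ℂ)‖ = |c.im| := by
      have : c - ((c.re : ℝ) : ℂ) = (c.im : ℂ) * Complex.I := by
        apply Complex.ext <;> simp
      rw [this, norm_mul, Complex.norm_I, mul_one, Complex.norm_real, Real.norm_eq_abs]
    calc ‖u - ((c.re : ℝ) : ℂ)‖ = ‖(u - c) + (c - ((c.re : ℝ) : ℂ))‖ := by rw [hsplit]
      _ ≤ ‖u - c‖ + ‖c - ((c.re : ℝ) : ℂ)‖ := norm_add_le _ _
      _ ≤ ρ + |c.im| := by rw [hci]; linarith
  exact succ_of_nonreal_crit_disc_either hE hv hu huim hua hdepth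

end RhW08.ClusterQM
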